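import Summits.AtomisticToContinuum.Crystallization.Theorems.ExcessDecayLiouvilleHcpLiouvilleBlowdownNextLevel

/-!
# `ExcessDecayLiouville.HcpLiouville` (stmt-AtomisticToContinuum-9332), line `Sketch` (skeleton v4): Caccioppoli levels `0` and `1`

Helper for stub `stub_interior` (step (4) of the interior estimate for `L`-harmonic fields): the first two of the four
Caccioppoli levels for the localised field `ẑ = 𝟙_{B_{4R/5}}(z − m)` of an `L`-harmonic field `z` on `B_R(c)`
(`R ≥ 400`): `blowdown_level0` (registered) bounds the nearest-neighbour energy of `ẑ` on `B_{18R/40−2}(c)` by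
`A₀ K R⁻² W`, `blowdown_level1` that of each generator difference `ẑ(· + Ae₁) − ẑ` on `B_{15R/40−2}(c)` by
`A₁ K² R⁻⁴ W`, where `W = oscAt S z c R m + Y₀²R⁻¹ + Y₂²R⁻³`, `K ≥ max(C_L/κ, 1)` and `C_L` is the constant of one
Caccioppoli level (`blowdown_levelStep`, taken as a hypothesis).  Rows of `ẑ` are the far field (…Localise), forced
by kernel differences (…Forcing); the arithmetic is `blowdown_levelArith` / `Blowdown.next_level`.
All `[folklore]`; a `--supports` helper for item stmt-AtomisticToContinuum-9332, nothing here closes an item.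
-/

noncomputable section

namespace Summit.AtomisticToContinuum.Crystallization.Theorems.ExcessDecayLiouville

open scoped BigOperators Topology Classical InnerProductSpace RealInnerProductSpace
open Literature.MathematicalPhysics.StatisticalMechanics
open Summit.AtomisticToContinuum.Crystallization.Theses.ExcessDecayLiouville
open Summit.AtomisticToContinuum.Crystallization.Theorems.PhononStabilityNegative
open LevelOne

/-- **Level `0`**: the nearest-neighbour energy of the localised field on `B_{18R/40 − 2}(c)` is
`≤ A₀·K·R⁻²·W`. [folklore] -/
theorem blowdown_level0 : ∀ (C_L κ K : ℝ) (t : Fin 2 → (EuclideanSpace ℝ (Fin 3))) (A : (EuclideanSpace ℝ (Fin 3)) →L[ℝ] (EuclideanSpace ℝ (Fin 3))),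
    (∀ (κ : ℝ) (t : Fin 2 → (EuclideanSpace ℝ (Fin 3))) (A : (EuclideanSpace ℝ (Fin 3)) →L[ℝ] (EuclideanSpace ℝ (Fin 3))), 0 < κ → Adm₀ A → Inner₀ t A → Blowdown.PSIneq κ t A →
      ∀ (F g : (EuclideanSpace ℝ (Fin 3)) → (EuclideanSpace ℝ (Fin 3))) (c : (EuclideanSpace ℝ (Fin 3))) (ρ₁ δ ρK R₀ Γ μ : ℝ), 4 ≤ ρ₁ → 1 ≤ δ → δ ≤ ρ₁ → ρ₁ + 2 * δ ≤ ρK → ρK ≤ R₀ →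
        0 ≤ Γ → 0 < μ → (∀ q : Sites₀ t A, R₀ < dist (q : (EuclideanSpace ℝ (Fin 3))) c → F q = 0) →
        (∀ p : Sites₀ t A, dist (p : (EuclideanSpace ℝ (Fin 3))) c ≤ ρ₁ + δ →
          HasSum (fun q : Sites₀ t A => forceConst ((p : (EuclideanSpace ℝ (Fin 3))) - q) (F p - F q)) (g p)) →
        (∀ p : Sites₀ t A, dist (p : (EuclideanSpace ℝ (Fin 3))) c ≤ ρ₁ + δ → ‖g p‖ ^ 2 ≤ Γ) →
        Blowdown.nnEnergy (Sites₀ t A) F c (ρ₁ - 2) ≤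
          C_L / κ * ((δ⁻¹) ^ 2 * Blowdown.oscAt (Sites₀ t A) F c ρK 0 + δ ^ 2 * ρK ^ 3 * Γ +
            (δ⁻¹) ^ 8 * (μ * R₀ ^ 3 * Blowdown.oscAt (Sites₀ t A) F c R₀ 0 +
              μ⁻¹ * ρK ^ 3 * Blowdown.oscAt (Sites₀ t A) F c ρK 0))) →
    0 < κ → Adm₀ A → Inner₀ t A → Blowdown.PSIneq κ t A →
    ∀ (z b zh : (EuclideanSpace ℝ (Fin 3)) → (EuclideanSpace ℝ (Fin 3))) (c m : (EuclideanSpace ℝ (Fin 3))) (R Y₀ Y₂ : ℝ), 400 ≤ R → 0 ≤ Y₀ → 0 ≤ Y₂ →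
      (∀ p ∈ Sites₀ t A, ‖z p - m - b p‖ ≤ Y₀) →
      Summable (fun p : Sites₀ t A => ‖b p‖ ^ 2) → (∑' p : Sites₀ t A, ‖b p‖ ^ 2) ≤ Y₂ ^ 2 →
      Blowdown.IsHarmonicOn (Sites₀ t A) z c R →
      (∀ x, zh x = if dist x c ≤ 4 * R / 5 then z x - m else 0) → 1 ≤ K → C_L / κ ≤ K →
      Blowdown.nnEnergy (Sites₀ t A) zh c (18 * (R / 40) - 2) ≤ 1013107200001600 * K * (R⁻¹) ^ 2 * (Blowdown.oscAt (Sites₀ t A) z c R m + Y₀ ^ 2 * R⁻¹ + Y₂ ^ 2 * (R⁻¹) ^ 3) := by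
  intro C_L κ K t A hL hκ hA hI hPS z b zh c m R Y₀ Y₂ hR hY₀ hY₂ ha hb hb2 hz hzh hK1 hKC
  obtain ⟨gens, hgens⟩ : ∃ gens : Finset (EuclideanSpace ℝ (Fin 3)),
      gens = {triangularVec₁ 1, triangularVec₂ 1, layerNormal (2 * Real.sqrt (2 / 3))} := ⟨_, rfl⟩
  have hgen : ∀ {e : (EuclideanSpace ℝ (Fin 3))}, e ∈ gens → e ∈ Λ₀ ∧ ‖A e‖ ≤ 2 := fun he =>
    Blowdown.gen_mem_and_norm_le hA (by rwa [hgens] at he)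
  have hgen' : ∀ {e : (EuclideanSpace ℝ (Fin 3))}, e ∈ gens → e ∈ ({triangularVec₁ 1, triangularVec₂ 1, layerNormal (2 * Real.sqrt (2 / 3))} : Finset (EuclideanSpace ℝ (Fin 3))) := fun he => by rwa [hgens] at he
  have hR1 : 1 ≤ R := by linarith
  have hR0 : 0 < R := by linarith
  have hR16 : 16 ≤ R := by linarith
  have hR64 : 64 ≤ R := by linarith
  have hK0 : 0 ≤ K := by linarith
  have hosc0 : 0 ≤ Blowdown.oscAt (Sites₀ t A) z c R m := Blowdown.oscAt_nonneg _ _ _ _ _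
  have hu0 : 0 ≤ R⁻¹ := by positivity
  have hW₀0 : 0 ≤ (Blowdown.oscAt (Sites₀ t A) z c R m + Y₀ ^ 2 * R⁻¹ + Y₂ ^ 2 * (R⁻¹) ^ 3) := by positivity
  have hYW : Y₀ ^ 2 * R⁻¹ + Y₂ ^ 2 * (R⁻¹) ^ 3 ≤ (Blowdown.oscAt (Sites₀ t A) z c R m + Y₀ ^ 2 * R⁻¹ + Y₂ ^ 2 * (R⁻¹) ^ 3) := by linarith
  have hoscW : Blowdown.oscAt (Sites₀ t A) z c R m ≤ (Blowdown.oscAt (Sites₀ t A) z c R m + Y₀ ^ 2 * R⁻¹ + Y₂ ^ 2 * (R⁻¹) ^ 3) := by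
    have : 0 ≤ Y₀ ^ 2 * R⁻¹ + Y₂ ^ 2 * (R⁻¹) ^ 3 := by positivity
    linarith
  have hY := Blowdown.norm_sub_le_Ybar hY₂ ha hb hb2
  obtain ⟨g₀, hg₀⟩ : ∃ g₀ : (EuclideanSpace ℝ (Fin 3)) → (EuclideanSpace ℝ (Fin 3)), ∀ y, g₀ y =
      ∑' q : Sites₀ t A, (if dist (q : (EuclideanSpace ℝ (Fin 3))) c ≤ 4 * R / 5 then (0 : (EuclideanSpace ℝ (Fin 3)))
        else forceConst (y - q) (z q - m)) := ⟨_, fun _ => rfl⟩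
  have hsupp0 : ∀ q : Sites₀ t A, 4 * R / 5 < dist (q : (EuclideanSpace ℝ (Fin 3))) c → zh q = 0 := fun q hq => by
    rw [hzh, if_neg (not_le.2 hq)]
  have hrows0 : ∀ p : Sites₀ t A, dist (p : (EuclideanSpace ℝ (Fin 3))) c ≤ 4 * R / 5 →
      HasSum (fun q : Sites₀ t A => forceConst ((p : (EuclideanSpace ℝ (Fin 3))) - q) (zh p - zh q)) (g₀ p) := by
    intro p hp
    rw [hg₀]
    exact Blowdown.hasSum_row_localise hA hI hY hz hzh p hp (by linarith)
  have hM0 : Blowdown.oscAt (Sites₀ t A) zh c (4 * R / 5) 0 ≤ (Blowdown.oscAt (Sites₀ t A) z c R m + Y₀ ^ 2 * R⁻¹ + Y₂ ^ 2 * (R⁻¹) ^ 3) :=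
    (Blowdown.oscAt_localise_le hA hI hR0.le hzh).trans hoscW
  have hW1 : (Blowdown.oscAt (Sites₀ t A) z c R m + Y₀ ^ 2 * R⁻¹ + Y₂ ^ 2 * (R⁻¹) ^ 3) ≤ K * (Blowdown.oscAt (Sites₀ t A) z c R m + Y₀ ^ 2 * R⁻¹ + Y₂ ^ 2 * (R⁻¹) ^ 3) := le_mul_of_one_le_left hW₀0 hK1
  have hKW0 : 0 ≤ K * (Blowdown.oscAt (Sites₀ t A) z c R m + Y₀ ^ 2 * R⁻¹ + Y₂ ^ 2 * (R⁻¹) ^ 3) := by positivity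
  have hforce0 : ∀ p : Sites₀ t A, dist (p : (EuclideanSpace ℝ (Fin 3))) c ≤ R / 2 →
      ‖g₀ p‖ ^ 2 ≤ 1000000000000000 * (Y₀ ^ 2 * (R⁻¹) ^ 10 + Y₂ ^ 2 * (R⁻¹) ^ 13) := by
    intro p hp
    rw [hg₀]
    exact Blowdown.farField_sq_le₀ hA hI hR16 hY₀ hY₂ ha hb hb2 hp
  have hraw0 := hL κ t A hκ hA hI hPS zh g₀ c (18 * (R / 40)) (R / 40) (20 * (R / 40)) (4 * R / 5)
    (1000000000000000 * (Y₀ ^ 2 * (R⁻¹) ^ 10 + Y₂ ^ 2 * (R⁻¹) ^ 13)) ((R⁻¹) ^ 0)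
    (by linarith) (by linarith) (by linarith) (by linarith) (by linarith) (by positivity) (by positivity)
    hsupp0 (fun p hp => hrows0 p (by linarith)) (fun p hp => hforce0 p (by linarith))
  have hX0 : 0 ≤ ((R / 40)⁻¹) ^ 2 * Blowdown.oscAt (Sites₀ t A) zh c (20 * (R / 40)) 0 +
      (R / 40) ^ 2 * (20 * (R / 40)) ^ 3 * (1000000000000000 * (Y₀ ^ 2 * (R⁻¹) ^ 10 + Y₂ ^ 2 * (R⁻¹) ^ 13)) +
      ((R / 40)⁻¹) ^ 8 * ((R⁻¹) ^ 0 * (4 * R / 5) ^ 3 * Blowdown.oscAt (Sites₀ t A) zh c (4 * R / 5) 0 +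
        ((R⁻¹) ^ 0)⁻¹ * (20 * (R / 40)) ^ 3 * Blowdown.oscAt (Sites₀ t A) zh c (20 * (R / 40)) 0) := by
    have := Blowdown.oscAt_nonneg (Sites₀ t A) zh c (20 * (R / 40)) 0
    have := Blowdown.oscAt_nonneg (Sites₀ t A) zh c (4 * R / 5) 0
    positivity
  have hE0 : Blowdown.nnEnergy (Sites₀ t A) zh c (18 * (R / 40) - 2) ≤
      (1600 * 1 + 1000000000000000 + 40 ^ 8 * (4 ^ 0 + 1)) * K * (R⁻¹) ^ (2 * 0 + 2) * (Blowdown.oscAt (Sites₀ t A) z c R m + Y₀ ^ 2 * R⁻¹ + Y₂ ^ 2 * (R⁻¹) ^ 3) := by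
    refine Blowdown.level_arith (k := 0) (a := 1) (hE := hraw0.trans (mul_le_mul_of_nonneg_right hKC hX0))
      (by norm_num) hR1 hK0 hW₀0 zero_le_one (by norm_num) (Blowdown.oscAt_nonneg _ _ _ _ _) ?_
      (Blowdown.oscAt_nonneg _ _ _ _ _) ?_ (by positivity) ?_ (by positivity) (by linarith) (by positivity) (by linarith)
    · have h1 := Blowdown.oscAt_zero_mono hA hI zh c (show 20 * (R / 40) ≤ 4 * R / 5 by linarith)
      have : (1 : ℝ) * (R⁻¹) ^ (2 * 0) * (Blowdown.oscAt (Sites₀ t A) z c R m + Y₀ ^ 2 * R⁻¹ + Y₂ ^ 2 * (R⁻¹) ^ 3) = (Blowdown.oscAt (Sites₀ t A) z c R m + Y₀ ^ 2 * R⁻¹ + Y₂ ^ 2 * (R⁻¹) ^ 3) := by norm_num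
      rw [this]; exact h1.trans hM0
    · rw [pow_zero, one_mul]; exact hM0
    · exact Blowdown.forcing_arith hR1 hYW (by norm_num) (n := 2) (m := 2 * 0 + 2) (by norm_num) (le_of_eq (by norm_num))
  have hc : ((1600 * 1 + 1000000000000000 + 40 ^ 8 * (4 ^ 0 + 1)) : ℝ) * K * (R⁻¹) ^ (2 * 0 + 2) * (Blowdown.oscAt (Sites₀ t A) z c R m + Y₀ ^ 2 * R⁻¹ + Y₂ ^ 2 * (R⁻¹) ^ 3) =
      1013107200001600 * K * (R⁻¹) ^ 2 * (Blowdown.oscAt (Sites₀ t A) z c R m + Y₀ ^ 2 * R⁻¹ + Y₂ ^ 2 * (R⁻¹) ^ 3) := by norm_num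
  rw [hc] at hE0
  exact hE0

/-- **Level `1`**: the energy of each generator difference of the localised field on `B_{15R/40 − 2}(c)` is
`≤ A₁·K²·R⁻⁴·W`. [folklore] -/
theorem blowdown_level1 : ∀ (C_L κ K : ℝ) (t : Fin 2 → (EuclideanSpace ℝ (Fin 3))) (A : (EuclideanSpace ℝ (Fin 3)) →L[ℝ] (EuclideanSpace ℝ (Fin 3))),
    (∀ (κ : ℝ) (t : Fin 2 → (EuclideanSpace ℝ (Fin 3))) (A : (EuclideanSpace ℝ (Fin 3)) →L[ℝ] (EuclideanSpace ℝ (Fin 3))), 0 < κ → Adm₀ A → Inner₀ t A → Blowdown.PSIneq κ t A →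
      ∀ (F g : (EuclideanSpace ℝ (Fin 3)) → (EuclideanSpace ℝ (Fin 3))) (c : (EuclideanSpace ℝ (Fin 3))) (ρ₁ δ ρK R₀ Γ μ : ℝ), 4 ≤ ρ₁ → 1 ≤ δ → δ ≤ ρ₁ → ρ₁ + 2 * δ ≤ ρK → ρK ≤ R₀ →
        0 ≤ Γ → 0 < μ → (∀ q : Sites₀ t A, R₀ < dist (q : (EuclideanSpace ℝ (Fin 3))) c → F q = 0) →
        (∀ p : Sites₀ t A, dist (p : (EuclideanSpace ℝ (Fin 3))) c ≤ ρ₁ + δ →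
          HasSum (fun q : Sites₀ t A => forceConst ((p : (EuclideanSpace ℝ (Fin 3))) - q) (F p - F q)) (g p)) →
        (∀ p : Sites₀ t A, dist (p : (EuclideanSpace ℝ (Fin 3))) c ≤ ρ₁ + δ → ‖g p‖ ^ 2 ≤ Γ) →
        Blowdown.nnEnergy (Sites₀ t A) F c (ρ₁ - 2) ≤
          C_L / κ * ((δ⁻¹) ^ 2 * Blowdown.oscAt (Sites₀ t A) F c ρK 0 + δ ^ 2 * ρK ^ 3 * Γ +
            (δ⁻¹) ^ 8 * (μ * R₀ ^ 3 * Blowdown.oscAt (Sites₀ t A) F c R₀ 0 +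
              μ⁻¹ * ρK ^ 3 * Blowdown.oscAt (Sites₀ t A) F c ρK 0))) →
    0 < κ → Adm₀ A → Inner₀ t A → Blowdown.PSIneq κ t A →
    ∀ (z b zh : (EuclideanSpace ℝ (Fin 3)) → (EuclideanSpace ℝ (Fin 3))) (c m : (EuclideanSpace ℝ (Fin 3))) (R Y₀ Y₂ : ℝ), 400 ≤ R → 0 ≤ Y₀ → 0 ≤ Y₂ →
      (∀ p ∈ Sites₀ t A, ‖z p - m - b p‖ ≤ Y₀) →
      Summable (fun p : Sites₀ t A => ‖b p‖ ^ 2) → (∑' p : Sites₀ t A, ‖b p‖ ^ 2) ≤ Y₂ ^ 2 →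
      Blowdown.IsHarmonicOn (Sites₀ t A) z c R →
      (∀ x, zh x = if dist x c ≤ 4 * R / 5 then z x - m else 0) → 1 ≤ K → C_L / κ ≤ K →
      ∀ e₁ ∈ ({triangularVec₁ 1, triangularVec₂ 1, layerNormal (2 * Real.sqrt (2 / 3))} : Finset (EuclideanSpace ℝ (Fin 3))),
        Blowdown.nnEnergy (Sites₀ t A) (fun x => zh (x + A e₁) - zh x) c (15 * (R / 40) - 2) ≤
          26567997390205855334410240000 * K * (R⁻¹) ^ 4 * (K * (Blowdown.oscAt (Sites₀ t A) z c R m + Y₀ ^ 2 * R⁻¹ + Y₂ ^ 2 * (R⁻¹) ^ 3)) := by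
  intro C_L κ K t A hL hκ hA hI hPS z b zh c m R Y₀ Y₂ hR hY₀ hY₂ ha hb hb2 hz hzh hK1 hKC
  obtain ⟨gens, hgens⟩ : ∃ gens : Finset (EuclideanSpace ℝ (Fin 3)),
      gens = {triangularVec₁ 1, triangularVec₂ 1, layerNormal (2 * Real.sqrt (2 / 3))} := ⟨_, rfl⟩
  have hgen : ∀ {e : (EuclideanSpace ℝ (Fin 3))}, e ∈ gens → e ∈ Λ₀ ∧ ‖A e‖ ≤ 2 := fun he =>
    Blowdown.gen_mem_and_norm_le hA (by rwa [hgens] at he)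
  have hgen' : ∀ {e : (EuclideanSpace ℝ (Fin 3))}, e ∈ gens → e ∈ ({triangularVec₁ 1, triangularVec₂ 1, layerNormal (2 * Real.sqrt (2 / 3))} : Finset (EuclideanSpace ℝ (Fin 3))) := fun he => by rwa [hgens] at he
  have hR1 : 1 ≤ R := by linarith
  have hR0 : 0 < R := by linarith
  have hR16 : 16 ≤ R := by linarith
  have hR64 : 64 ≤ R := by linarith
  have hK0 : 0 ≤ K := by linarith
  have hosc0 : 0 ≤ Blowdown.oscAt (Sites₀ t A) z c R m := Blowdown.oscAt_nonneg _ _ _ _ _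
  have hu0 : 0 ≤ R⁻¹ := by positivity
  have hW₀0 : 0 ≤ (Blowdown.oscAt (Sites₀ t A) z c R m + Y₀ ^ 2 * R⁻¹ + Y₂ ^ 2 * (R⁻¹) ^ 3) := by positivity
  have hYW : Y₀ ^ 2 * R⁻¹ + Y₂ ^ 2 * (R⁻¹) ^ 3 ≤ (Blowdown.oscAt (Sites₀ t A) z c R m + Y₀ ^ 2 * R⁻¹ + Y₂ ^ 2 * (R⁻¹) ^ 3) := by linarith
  have hoscW : Blowdown.oscAt (Sites₀ t A) z c R m ≤ (Blowdown.oscAt (Sites₀ t A) z c R m + Y₀ ^ 2 * R⁻¹ + Y₂ ^ 2 * (R⁻¹) ^ 3) := by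
    have : 0 ≤ Y₀ ^ 2 * R⁻¹ + Y₂ ^ 2 * (R⁻¹) ^ 3 := by positivity
    linarith
  have hY := Blowdown.norm_sub_le_Ybar hY₂ ha hb hb2
  obtain ⟨g₀, hg₀⟩ : ∃ g₀ : (EuclideanSpace ℝ (Fin 3)) → (EuclideanSpace ℝ (Fin 3)), ∀ y, g₀ y =
      ∑' q : Sites₀ t A, (if dist (q : (EuclideanSpace ℝ (Fin 3))) c ≤ 4 * R / 5 then (0 : (EuclideanSpace ℝ (Fin 3)))
        else forceConst (y - q) (z q - m)) := ⟨_, fun _ => rfl⟩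
  have hsupp0 : ∀ q : Sites₀ t A, 4 * R / 5 < dist (q : (EuclideanSpace ℝ (Fin 3))) c → zh q = 0 := fun q hq => by
    rw [hzh, if_neg (not_le.2 hq)]
  have hrows0 : ∀ p : Sites₀ t A, dist (p : (EuclideanSpace ℝ (Fin 3))) c ≤ 4 * R / 5 →
      HasSum (fun q : Sites₀ t A => forceConst ((p : (EuclideanSpace ℝ (Fin 3))) - q) (zh p - zh q)) (g₀ p) := by
    intro p hp
    rw [hg₀]
    exact Blowdown.hasSum_row_localise hA hI hY hz hzh p hp (by linarith)
  have hM0 : Blowdown.oscAt (Sites₀ t A) zh c (4 * R / 5) 0 ≤ (Blowdown.oscAt (Sites₀ t A) z c R m + Y₀ ^ 2 * R⁻¹ + Y₂ ^ 2 * (R⁻¹) ^ 3) :=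
    (Blowdown.oscAt_localise_le hA hI hR0.le hzh).trans hoscW
  have hW1 : (Blowdown.oscAt (Sites₀ t A) z c R m + Y₀ ^ 2 * R⁻¹ + Y₂ ^ 2 * (R⁻¹) ^ 3) ≤ K * (Blowdown.oscAt (Sites₀ t A) z c R m + Y₀ ^ 2 * R⁻¹ + Y₂ ^ 2 * (R⁻¹) ^ 3) := le_mul_of_one_le_left hW₀0 hK1
  have hKW0 : 0 ≤ K * (Blowdown.oscAt (Sites₀ t A) z c R m + Y₀ ^ 2 * R⁻¹ + Y₂ ^ 2 * (R⁻¹) ^ 3) := by positivity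
  have hE0 := blowdown_level0 C_L κ K t A hL hκ hA hI hPS z b zh c m R Y₀ Y₂ hR hY₀ hY₂ ha hb hb2 hz hzh hK1 hKC
  intro e₁ he₁g
  have he₁ : e₁ ∈ gens := by rw [hgens]; exact he₁g
  obtain ⟨he₁Λ, hAe₁⟩ := hgen he₁
  have h := Blowdown.next_level hL hκ hA hI hPS (k := 1) (a := 4 * 1013107200001600) (g := 10000000000000000000000000)
      (Γb := 10000000000000000000000000 * (Y₀ ^ 2 * (R⁻¹) ^ 12 + Y₂ ^ 2 * (R⁻¹) ^ 15)) (W := K * (Blowdown.oscAt (Sites₀ t A) z c R m + Y₀ ^ 2 * R⁻¹ + Y₂ ^ 2 * (R⁻¹) ^ 3)) (e := e₁)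
      (by norm_num) (by norm_num) hR he₁g hK1 hKC hKW0
      (by positivity) (by norm_num) hsupp0 le_rfl (by linarith) hrows0 (by push_cast; linarith) ?_ (by positivity) ?_ ?_ ?_
  · have hc : ((1600 * (4 * 1013107200001600) + 10000000000000000000000000 + 40 ^ 8 * (4 ^ 1 + 4 * 1013107200001600)) : ℝ) * K * (R⁻¹) ^ (2 * 1 + 2) * (K * (Blowdown.oscAt (Sites₀ t A) z c R m + Y₀ ^ 2 * R⁻¹ + Y₂ ^ 2 * (R⁻¹) ^ 3)) =
        26567997390205855334410240000 * K * (R⁻¹) ^ 4 * (K * (Blowdown.oscAt (Sites₀ t A) z c R m + Y₀ ^ 2 * R⁻¹ + Y₂ ^ 2 * (R⁻¹) ^ 3)) := by norm_num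
    have e : (18 - 3 * ((1 : ℕ) : ℝ)) * (R / 40) - 2 = 15 * (R / 40) - 2 := by push_cast; ring
    rw [hc, e] at h
    exact h
  · intro p hp
    push_cast at hp
    rw [hg₀, hg₀]
    exact Blowdown.farField_sq_le₁ hA hI hR64 hY₀ hY₂ ha hb hb2 p.2 (add_mem_sites₀ p.2 he₁Λ) (by linarith) hAe₁
  · exact Blowdown.forcing_arith hR1 (hYW.trans hW1) (by norm_num) (n := 4) (m := 2 * 1 + 2) (by norm_num)
      (le_of_eq (by norm_num))
  · rw [show ((4 : ℝ)) ^ (1 - 1) = 1 by norm_num, one_mul]; exact hM0.trans hW1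
  · have e : (21 - 3 * ((1 : ℕ) : ℝ)) * (R / 40) - 2 = 18 * (R / 40) - 2 := by push_cast; ring
    rw [e]
    calc 4 * Blowdown.nnEnergy (Sites₀ t A) zh c (18 * (R / 40) - 2) ≤ 4 * (1013107200001600 * K * (R⁻¹) ^ 2 * (Blowdown.oscAt (Sites₀ t A) z c R m + Y₀ ^ 2 * R⁻¹ + Y₂ ^ 2 * (R⁻¹) ^ 3)) := by
          linarith [hE0]
      _ = 4 * 1013107200001600 * (R⁻¹) ^ (2 * 1) * (K * (Blowdown.oscAt (Sites₀ t A) z c R m + Y₀ ^ 2 * R⁻¹ + Y₂ ^ 2 * (R⁻¹) ^ 3)) := by ring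

end Summit.AtomisticToContinuum.Crystallization.Theorems.ExcessDecayLiouville

end
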